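import Summits.Ventures.Crystal3D.Theorems.StickyWulffConstantGenericWallFloorStackWalkWordSepTwo
import HarnessLib

/-!
# The WORD CRITERION with the FAR ray allowed one step along the path (cells `(l,c) ∈ {(0,0),(0,1)}`)
# (crux `GenericWallFloor`, line `WallLedgerG`; forced-chain localisation of the stack ledger, brick 8)

HONEST FRAMING. Part of the venture `Summits/Ventures/Crystal3D` (cell `crystal3d-full`), helper `--supports` the
crux `GenericWallFloor` (stmt-Ventures-19480) of `route-Ventures-StickyWulffConstant`, registered line `WallLedgerG`,
open stub `stub_twoSlabAdhesion` (general fillings).  Companion of `not_coaxial_of_word_two` (`…StackWalkWordSepTwo`,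
near side): here the NEAR steep slot lies in the first mirror plane (`l = 0`) and the FAR grain's forced ray may take
one step along the connecting path (`c ≤ 1`), for chain pairs at twin distance `k ≥ 3`:

**`not_coaxial_of_word_farTwo`.**  `A₂·Λ₀ = (wordFrame A₁ (μ_k :: μ_{k−1} :: κ₁))·Λ₀`, `κ₁ ≠ []`, the word reduced;
`⟪u₁, κ₁.getLast⟫ = 0`; and whenever the far first push normal is `±W μ_k` (`W = wordFrame A₁ κ`, positive on `A₂u₂`),
every highest `n₁`-positive slot `q` of `R_{n₁}A₂` (w.r.t. the far vertical `z₂`) has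
`W⁻¹ A₂ (R_{n₁}A₂)⁻¹ (2√(2/3)·R_{n₁}A₂ q − n₁) ≠ ±μ_{k−1}`.  Then no frame on a sound well-formed stack over
`(A₁,u₁,0)` is co-axial with one over `(A₂,u₂,0)`.
Mechanism: `stackWord_lastTwo_ne_far` (the far word's bottom two letters, transported by `S = W⁻¹A₂`: `R_{S b₁} ≠ R_{μ_k}`
or `R_{S b₂} ≠ R_{μ_{k−1}}`); one CANCELLATION `S b₁ :: μ_k` inside the transported word when the first junction closes
(`wordFrame_append_cons_cons_cancel`), after which the word is again reduced, has length `≥ 2` and still ends with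
`κ₁`'s last letter (orthogonal to `u₁`) — so `false_of_map_reflection_eq` applies as in `not_coaxial_of_word`.

WHAT THIS IS NOT: not the stub; the ray-aligned core `l + c ≥ k − 1` remains; F-C1 not moved.
-/

noncomputable section

namespace Summit.Ventures.Crystal3D.Theorems

open Summit.Ventures.Crystal3D Finset
open Literature.MathematicalPhysics.StatisticalMechanics (fccStacking barlowStacking IsHaggSeq)
open scoped InnerProductSpace

/-! ### The far grain's first two letters, transported to the near base -/

/-- **Property P2 for the FAR grain, transported.**  For a sound well-formed stack over `(A₂, u₂, 0)` (vertical `z₂`)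
and an isometry `S` with `W ∘ S = A₂`: the word has length `≤ 1`, or its last two letters `b₂, b₁` satisfy
`R_{S b₁} ≠ R_{μ}` or `R_{S b₂} ≠ R_{μ'}` — provided the level-two hypothesis: when the first push normal is `±W μ`, the
best capper's forced second normal, transported by `W⁻¹ ∘ A₂ ∘ (twin frame)⁻¹`, is not `±μ'`. -/
theorem stackWord_lastTwo_ne_far {A₂ W S : EuclideanSpace ℝ (Fin 3) ≃ₗᵢ[ℝ] EuclideanSpace ℝ (Fin 3)}
    {u₂ μ μ' z₂ : EuclideanSpace ℝ (Fin 3)} (hWS : ∀ x, W (S x) = A₂ x) (hμ : ‖μ‖ = 1) (hμ' : ‖μ'‖ = 1)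
    (hsecond : ∀ n₁ : EuclideanSpace ℝ (Fin 3), (n₁ = W μ ∨ n₁ = -W μ) → ⟪A₂ u₂, n₁⟫_ℝ = Real.sqrt (2 / 3) →
      ∀ q ∈ fccSlots, 0 < ⟪twinFrame A₂ n₁ q, n₁⟫_ℝ →
        (∀ q' ∈ fccSlots, 0 < ⟪twinFrame A₂ n₁ q', n₁⟫_ℝ → ⟪twinFrame A₂ n₁ q', z₂⟫_ℝ ≤ ⟪twinFrame A₂ n₁ q, z₂⟫_ℝ) →
        W.symm (A₂ ((twinFrame A₂ n₁).symm ((2 * Real.sqrt (2 / 3)) • twinFrame A₂ n₁ q - n₁))) ≠ μ' ∧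
        W.symm (A₂ ((twinFrame A₂ n₁).symm ((2 * Real.sqrt (2 / 3)) • twinFrame A₂ n₁ q - n₁))) ≠ -μ')
    (r : List WalkEntry) (e : WalkEntry) (hS : StackSound z₂ (e :: r)) (hW : StackWF z₂ (e :: r))
    (hl : (e :: r).getLast? = some ⟨A₂, u₂, 0⟩) :
    (stackWord (e :: r)).length ≤ 1 ∨ ∃ (w : List (EuclideanSpace ℝ (Fin 3))) (b₂ b₁ : EuclideanSpace ℝ (Fin 3)),
      stackWord (e :: r) = w ++ [b₂, b₁] ∧
      ((ℝ ∙ S b₁)ᗮ.reflection ≠ (ℝ ∙ μ)ᗮ.reflection ∨ (ℝ ∙ S b₂)ᗮ.reflection ≠ (ℝ ∙ μ')ᗮ.reflection) := by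
  have hr : 0 < Real.sqrt (2 / 3) := Real.sqrt_pos.2 (by norm_num)
  have hSx : ∀ x, S x = W.symm (A₂ x) := fun x => by rw [← hWS x, LinearIsometryEquiv.symm_apply_apply]
  by_cases hlen : 2 ≤ r.length
  swap
  · left; rw [length_stackWord_cons]; omega
  right
  obtain ⟨w, d₁, d₂, hw, hSo₁, hLi₁, hdir₁, hSo₂, hLi₂, hne⟩ := stackWord_lastTwo r e ⟨A₂, u₂, 0⟩ hlen hS hW hl
  refine ⟨w, d₁.frame.symm d₂.nrm, (A₂ : EuclideanSpace ℝ (Fin 3) ≃ₗᵢ[ℝ] EuclideanSpace ℝ (Fin 3)).symm d₁.nrm, hw, ?_⟩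
  have hn₁ : ‖d₁.nrm‖ = 1 := hSo₁.2.1
  have hSb₁ : S ((A₂ : EuclideanSpace ℝ (Fin 3) ≃ₗᵢ[ℝ] EuclideanSpace ℝ (Fin 3)).symm d₁.nrm) = W.symm d₁.nrm := by
    rw [hSx, LinearIsometryEquiv.apply_symm_apply]
  have hl₁u : ‖W.symm d₁.nrm‖ = 1 := by rw [LinearIsometryEquiv.norm_map, hn₁]
  rw [hSb₁]
  rcases Classical.em ((ℝ ∙ W.symm d₁.nrm)ᗮ.reflection = (ℝ ∙ μ)ᗮ.reflection) with hR₁ | hR₁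
  swap
  · exact Or.inl hR₁
  right
  have hpm : d₁.nrm = W μ ∨ d₁.nrm = -W μ := by
    rcases eq_or_eq_neg_of_reflection_eq hl₁u hμ hR₁ with h | h
    · left; rw [← h, LinearIsometryEquiv.apply_symm_apply]
    · right; rw [← LinearIsometryEquiv.apply_symm_apply W d₁.nrm, h, map_neg]
  have hpos₁ : ⟪A₂ u₂, d₁.nrm⟫_ℝ = Real.sqrt (2 / 3) := hLi₁.2
  have hfr₁ : d₁.frame = twinFrame A₂ d₁.nrm :=
    frame_eq_twinFrame_of_link (e := d₁) (e' := ⟨A₂, u₂, 0⟩) hn₁ hLi₁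
  have hmenuT : ∀ w ∈ fccSlots, ⟪twinFrame A₂ d₁.nrm w, d₁.nrm⟫_ℝ = 0 ∨
      ⟪twinFrame A₂ d₁.nrm w, d₁.nrm⟫_ℝ = Real.sqrt (2 / 3) ∨ ⟪twinFrame A₂ d₁.nrm w, d₁.nrm⟫_ℝ = -Real.sqrt (2 / 3) := by
    rw [← hfr₁]; exact hSo₁.2.2.1
  have hSne : (fccSlots.filter fun q => 0 < ⟪twinFrame A₂ d₁.nrm q, d₁.nrm⟫_ℝ).Nonempty := by
    obtain ⟨p, hp, hpn, -⟩ := exists_pos_slot_ne (twinFrame A₂ d₁.nrm) hn₁ hmenuT 0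
    exact ⟨p, Finset.mem_filter.2 ⟨hp, by rw [hpn]; exact hr⟩⟩
  obtain ⟨hqS, hqmax⟩ := bestCapper_spec (twinFrame A₂ d₁.nrm) d₁.nrm z₂ hSne
  rw [Finset.mem_filter] at hqS
  have hq : d₁.dir = bestCapper (twinFrame A₂ d₁.nrm) d₁.nrm z₂ := by rw [hdir₁, hfr₁]
  obtain ⟨hne₁, hne₂⟩ := hsecond d₁.nrm hpm hpos₁ _ hqS.1 hqS.2
    (fun q' hq' hpos' => hqmax q' (Finset.mem_filter.2 ⟨hq', hpos'⟩))
  have hn₂ : d₂.nrm = nextNormal d₁ := nrm_eq_nextNormal hSo₂ hLi₂ hSo₁ hne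
  have hl₂ : S (d₁.frame.symm d₂.nrm) =
      W.symm (A₂ ((twinFrame A₂ d₁.nrm).symm ((2 * Real.sqrt (2 / 3)) • twinFrame A₂ d₁.nrm
        (bestCapper (twinFrame A₂ d₁.nrm) d₁.nrm z₂) - d₁.nrm))) := by
    rw [hSx, hn₂, nextNormal, hq, hfr₁]
  intro hR₂
  have hl₂u : ‖S (d₁.frame.symm d₂.nrm)‖ = 1 := by
    rw [LinearIsometryEquiv.norm_map, LinearIsometryEquiv.norm_map]; exact hSo₂.2.1
  rcases eq_or_eq_neg_of_reflection_eq hl₂u hμ' hR₂ with h | h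
  · exact hne₁ (hl₂ ▸ h)
  · exact hne₂ (hl₂ ▸ h)

/-- Cancellation of a repeated mirror in the middle of a word. -/
theorem wordFrame_append_cons_cons_cancel (B : EuclideanSpace ℝ (Fin 3) ≃ₗᵢ[ℝ] EuclideanSpace ℝ (Fin 3))
    (α : List (EuclideanSpace ℝ (Fin 3))) {μ μ' : EuclideanSpace ℝ (Fin 3)}
    (h : (ℝ ∙ μ)ᗮ.reflection = (ℝ ∙ μ')ᗮ.reflection) (γ : List (EuclideanSpace ℝ (Fin 3))) :
    wordFrame B (α ++ μ :: μ' :: γ) = wordFrame B (α ++ γ) := by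
  rw [wordFrame_append, wordFrame_cons_cons_cancel B h γ, ← wordFrame_append]

/-! ### The word criterion with the far ray allowed one step along the path -/

/-- **Word criterion, far level two** (twin distance `k ≥ 3`; cells `(l, c) ∈ {(0,0), (0,1)}` of ROUTE.md §84 R41t).
The near steep slot `u₁` lies in the first mirror plane; the far steep slot is free, but whenever the far grain's first
push normal is the last mirror's normal `±W μ_k` (`W = wordFrame A₁ κ`), the best capper's forced second normal,
transported by `W⁻¹ ∘ A₂ ∘ (twin frame)⁻¹`, is not `±μ_{k−1}`.  Then no frame on a sound well-formed stack over
`(A₁,u₁,0)` is co-axial with one over `(A₂,u₂,0)` (vertical `z₂`). -/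
theorem not_coaxial_of_word_farTwo {A₁ A₂ : EuclideanSpace ℝ (Fin 3) ≃ₗᵢ[ℝ] EuclideanSpace ℝ (Fin 3)}
    {u₁ u₂ : EuclideanSpace ℝ (Fin 3)} (μk μk1 : EuclideanSpace ℝ (Fin 3)) (κ₁ : List (EuclideanSpace ℝ (Fin 3)))
    (hκ₁ : κ₁ ≠ [])
    (hκl : ∀ μ ∈ μk :: μk1 :: κ₁, ‖μ‖ = 1 ∧
      ∀ w ∈ fccSlots, ⟪w, μ⟫_ℝ = 0 ∨ ⟪w, μ⟫_ℝ = Real.sqrt (2 / 3) ∨ ⟪w, μ⟫_ℝ = -Real.sqrt (2 / 3))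
    (hκc : List.IsChain (fun μ μ' => ⟪μ, μ'⟫_ℝ = 1 / 3 ∨ ⟪μ, μ'⟫_ℝ = -1 / 3) (μk :: μk1 :: κ₁))
    (hA₂ : A₂ '' fccStacking 1 (Real.sqrt (2 / 3)) =
      (wordFrame A₁ (μk :: μk1 :: κ₁)) '' fccStacking 1 (Real.sqrt (2 / 3)))
    (hfirst : ∀ μ, κ₁.getLast? = some μ → ⟪u₁, μ⟫_ℝ = 0)
    {z₂ : EuclideanSpace ℝ (Fin 3)}
    (hsecond : ∀ n₁ : EuclideanSpace ℝ (Fin 3),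
      (n₁ = wordFrame A₁ (μk :: μk1 :: κ₁) μk ∨ n₁ = -wordFrame A₁ (μk :: μk1 :: κ₁) μk) →
      ⟪A₂ u₂, n₁⟫_ℝ = Real.sqrt (2 / 3) →
      ∀ q ∈ fccSlots, 0 < ⟪twinFrame A₂ n₁ q, n₁⟫_ℝ →
        (∀ q' ∈ fccSlots, 0 < ⟪twinFrame A₂ n₁ q', n₁⟫_ℝ → ⟪twinFrame A₂ n₁ q', z₂⟫_ℝ ≤ ⟪twinFrame A₂ n₁ q, z₂⟫_ℝ) →
        (wordFrame A₁ (μk :: μk1 :: κ₁)).symm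
            (A₂ ((twinFrame A₂ n₁).symm ((2 * Real.sqrt (2 / 3)) • twinFrame A₂ n₁ q - n₁))) ≠ μk1 ∧
        (wordFrame A₁ (μk :: μk1 :: κ₁)).symm
            (A₂ ((twinFrame A₂ n₁).symm ((2 * Real.sqrt (2 / 3)) • twinFrame A₂ n₁ q - n₁))) ≠ -μk1)
    {z₁ : EuclideanSpace ℝ (Fin 3)} {stk₁ stk₂ : List WalkEntry}
    (hS₁ : StackSound z₁ stk₁) (hW₁ : StackWF z₁ stk₁) (hl₁ : stk₁.getLast? = some ⟨A₁, u₁, 0⟩)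
    (hS₂ : StackSound z₂ stk₂) (hW₂ : StackWF z₂ stk₂) (hl₂ : stk₂.getLast? = some ⟨A₂, u₂, 0⟩)
    {e₁ e₂ : WalkEntry} (he₁ : e₁ ∈ stk₁) (he₂ : e₂ ∈ stk₂) :
    ¬ ∃ (L : EuclideanSpace ℝ (Fin 3) ≃ₗᵢ[ℝ] EuclideanSpace ℝ (Fin 3))
        (s₁ s₂ : EuclideanSpace ℝ (Fin 3)) (σ σ' : ℤ → ℤ), IsHaggSeq σ ∧ IsHaggSeq σ' ∧
        e₁.frame '' fccStacking 1 (Real.sqrt (2 / 3)) ⊆ (fun p => L p + s₁) '' barlowStacking 1 (Real.sqrt (2 / 3)) σ ∧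
        e₂.frame '' fccStacking 1 (Real.sqrt (2 / 3)) ⊆ (fun p => L p + s₂) '' barlowStacking 1 (Real.sqrt (2 / 3)) σ' := by
  obtain ⟨c, cs, rfl⟩ := List.exists_cons_of_ne_nil hκ₁
  set κ := μk :: μk1 :: c :: cs with hκdef
  intro hco
  have hr : 0 < Real.sqrt (2 / 3) := Real.sqrt_pos.2 (by norm_num)
  have hμk := hκl μk (by rw [hκdef]; simp)
  have hμk1 := hκl μk1 (by rw [hκdef]; simp)
  -- the last letter `μ₁` of the path word (first mirror met from `A₁`) is orthogonal to `u₁`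
  obtain ⟨μ₁, hμ₁⟩ : ∃ μ, (c :: cs).getLast? = some μ :=
    Option.ne_none_iff_exists'.1 (mt List.getLast?_eq_none_iff.1 (List.cons_ne_nil c cs))
  have hμ₁0 : ⟪u₁, μ₁⟫_ℝ = 0 := hfirst μ₁ hμ₁
  have hκlast : κ.getLast? = some μ₁ := by rw [hκdef, List.getLast?_cons_cons, List.getLast?_cons_cons, hμ₁]
  -- suffixes with the given tops
  obtain ⟨r₁, hS₁', hW₁', hl₁'⟩ := exists_suffix_of_mem stk₁ e₁ he₁ hS₁ hW₁
  obtain ⟨r₂, hS₂', hW₂', hl₂'⟩ := exists_suffix_of_mem stk₂ e₂ he₂ hS₂ hW₂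
  rw [hl₁] at hl₁'
  rw [hl₂] at hl₂'
  obtain ⟨hαl, hαc⟩ := stackWord_letters _ hS₁' hW₁'
  obtain ⟨hβl, hβc⟩ := stackWord_letters _ hS₂' hW₂'
  have hF₁ : e₁.frame = wordFrame A₁ (stackWord (e₁ :: r₁)) := by
    rw [frame_eq_wordFrame e₁ r₁ hS₁', stackBase_eq_of_getLast? hl₁']
  have hF₂ : e₂.frame = wordFrame A₂ (stackWord (e₂ :: r₂)) := by
    rw [frame_eq_wordFrame e₂ r₂ hS₂', stackBase_eq_of_getLast? hl₂']
  have hαpos : ∀ μ, (stackWord (e₁ :: r₁)).getLast? = some μ → ⟪u₁, μ⟫_ℝ = Real.sqrt (2 / 3) :=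
    fun μ hμ => inner_dir_getLast_stackWord r₁ e₁ ⟨A₁, u₁, 0⟩ hS₁' hl₁' μ hμ
  -- the lattice symmetry `S = W⁻¹ ∘ A₂`
  obtain ⟨S, hS⟩ : ∃ S : EuclideanSpace ℝ (Fin 3) ≃ₗᵢ[ℝ] EuclideanSpace ℝ (Fin 3),
      S = A₂.trans (wordFrame A₁ κ).symm := ⟨_, rfl⟩
  have hWS : ∀ x, wordFrame A₁ κ (S x) = A₂ x := fun x => by
    rw [hS, LinearIsometryEquiv.trans_apply, LinearIsometryEquiv.apply_symm_apply]
  have hA₂eq : A₂ = S.trans (wordFrame A₁ κ) :=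
    LinearIsometryEquiv.ext fun x => by rw [LinearIsometryEquiv.trans_apply, hWS]
  have hSfcc : S '' fccStacking 1 (Real.sqrt (2 / 3)) = fccStacking 1 (Real.sqrt (2 / 3)) := by
    rw [hS, LinearIsometryEquiv.coe_trans, Set.image_comp, hA₂, Set.image_image]
    simp
  have hSslots := image_fccSlots_eq_self_of_image_fcc S hSfcc
  have hSmem' : ∀ w ∈ fccSlots, S.symm w ∈ fccSlots := fun w hw => by
    have hw' : w ∈ (S : EuclideanSpace ℝ (Fin 3) → EuclideanSpace ℝ (Fin 3)) '' ↑fccSlots := by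
      rw [hSslots]; exact Finset.mem_coe.2 hw
    obtain ⟨w', hw', hw'eq⟩ := hw'
    rw [← hw'eq, LinearIsometryEquiv.symm_apply_apply]; exact Finset.mem_coe.1 hw'
  -- the far word and its transport
  set β := stackWord (e₂ :: r₂) with hβ
  have hβSl : ∀ μ ∈ β.map S, ‖μ‖ = 1 ∧
      ∀ w ∈ fccSlots, ⟪w, μ⟫_ℝ = 0 ∨ ⟪w, μ⟫_ℝ = Real.sqrt (2 / 3) ∨ ⟪w, μ⟫_ℝ = -Real.sqrt (2 / 3) := by
    intro μ hμ
    obtain ⟨ν, hν, rfl⟩ := List.mem_map.1 hμ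
    obtain ⟨hνu, hνm⟩ := hβl ν hν
    refine ⟨by rw [LinearIsometryEquiv.norm_map, hνu], fun w hw => ?_⟩
    have hsw : ⟪w, S ν⟫_ℝ = ⟪S.symm w, ν⟫_ℝ := by
      rw [← LinearIsometryEquiv.inner_map_map S (S.symm w) ν, LinearIsometryEquiv.apply_symm_apply]
    rw [hsw]; exact hνm _ (hSmem' w hw)
  have hβSc : List.IsChain (fun μ μ' => ⟪μ, μ'⟫_ℝ = 1 / 3 ∨ ⟪μ, μ'⟫_ℝ = -1 / 3) (β.map S) := by
    rw [List.isChain_map]; simpa only [LinearIsometryEquiv.inner_map_map] using hβc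
  have himg₀ : (e₂.frame : EuclideanSpace ℝ (Fin 3) → EuclideanSpace ℝ (Fin 3)) '' ↑fccSlots =
      (wordFrame A₁ (β.map S ++ κ) : EuclideanSpace ℝ (Fin 3) → EuclideanSpace ℝ (Fin 3)) '' ↑fccSlots := by
    rw [hF₂, hA₂eq, wordFrame_trans (wordFrame A₁ κ) S β (fun μ hμ => (hβl μ hμ).1), ← wordFrame_append,
      image_trans_eq, hSslots]
  have hP2far := stackWord_lastTwo_ne_far (A₂ := A₂) (W := wordFrame A₁ κ) (S := S) (z₂ := z₂) hWS hμk.1 hμk1.1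
    hsecond r₂ e₂ hS₂' hW₂' hl₂'
  -- two distinct non-antipodal unit model menu normals meet at `±1/3`
  have hjunction : ∀ x y : EuclideanSpace ℝ (Fin 3),
      (‖x‖ = 1 ∧ ∀ w ∈ fccSlots, ⟪w, x⟫_ℝ = 0 ∨ ⟪w, x⟫_ℝ = Real.sqrt (2 / 3) ∨ ⟪w, x⟫_ℝ = -Real.sqrt (2 / 3)) →
      (‖y‖ = 1 ∧ ∀ w ∈ fccSlots, ⟪w, y⟫_ℝ = 0 ∨ ⟪w, y⟫_ℝ = Real.sqrt (2 / 3) ∨ ⟪w, y⟫_ℝ = -Real.sqrt (2 / 3)) →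
      (ℝ ∙ x)ᗮ.reflection ≠ (ℝ ∙ y)ᗮ.reflection → (⟪x, y⟫_ℝ = 1 / 3 ∨ ⟪x, y⟫_ℝ = -1 / 3) := by
    intro x y hx hy hR
    rcases inner_modelMenu hx.1 hy.1 hx.2 hy.2 with h | h | h | h
    · exact absurd (by rw [(inner_eq_one_iff_of_norm_eq_one (𝕜 := ℝ) hx.1 hy.1).1 h]) hR
    · have heq : y = -x := eq_neg_of_inner_eq_neg_one' hx.1 hy.1 h
      exact absurd (by rw [heq, reflection_neg_eq hx.1]) hR
    · exact Or.inl h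
    · exact Or.inr h
  -- A REDUCED far word `γ` over `A₁` ending with `μ₁`, of length `≥ 2`, with the far frame's slot dozen
  have hfar : ∃ γ : List (EuclideanSpace ℝ (Fin 3)),
      (∀ μ ∈ γ, ‖μ‖ = 1 ∧
        ∀ w ∈ fccSlots, ⟪w, μ⟫_ℝ = 0 ∨ ⟪w, μ⟫_ℝ = Real.sqrt (2 / 3) ∨ ⟪w, μ⟫_ℝ = -Real.sqrt (2 / 3)) ∧
      List.IsChain (fun μ μ' => ⟪μ, μ'⟫_ℝ = 1 / 3 ∨ ⟪μ, μ'⟫_ℝ = -1 / 3) γ ∧ 2 ≤ γ.length ∧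
      (∃ μ, γ.getLast? = some μ ∧ ⟪u₁, μ⟫_ℝ = 0) ∧
      (e₂.frame : EuclideanSpace ℝ (Fin 3) → EuclideanSpace ℝ (Fin 3)) '' ↑fccSlots =
        (wordFrame A₁ γ : EuclideanSpace ℝ (Fin 3) → EuclideanSpace ℝ (Fin 3)) '' ↑fccSlots := by
    have hκtail_l : ∀ μ ∈ μk1 :: c :: cs, ‖μ‖ = 1 ∧
        ∀ w ∈ fccSlots, ⟪w, μ⟫_ℝ = 0 ∨ ⟪w, μ⟫_ℝ = Real.sqrt (2 / 3) ∨ ⟪w, μ⟫_ℝ = -Real.sqrt (2 / 3) :=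
      fun μ hμ => hκl μ (List.mem_cons_of_mem μk hμ)
    have hκtail_c : List.IsChain (fun μ μ' => ⟪μ, μ'⟫_ℝ = 1 / 3 ∨ ⟪μ, μ'⟫_ℝ = -1 / 3) (μk1 :: c :: cs) := hκc.tail
    have hκtail_last : (μk1 :: c :: cs).getLast? = some μ₁ := by rw [List.getLast?_cons_cons, hμ₁]
    rcases List.eq_nil_or_concat β with hβ0 | ⟨L, b₁, hβ1⟩
    swap; rw [List.concat_eq_append] at hβ1; swap
    · -- no far letters: `γ = κ`
      refine ⟨κ, hκl, hκc, by rw [hκdef]; simp, ⟨μ₁, hκlast, hμ₁0⟩, ?_⟩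
      rw [himg₀, hβ0, List.map_nil, List.nil_append]
    · have hb₁ : b₁ ∈ β := by rw [hβ1]; simp
      have hSb₁ := hβSl (S b₁) (List.mem_map.2 ⟨b₁, hb₁, rfl⟩)
      rcases Classical.em ((ℝ ∙ S b₁)ᗮ.reflection = (ℝ ∙ μk)ᗮ.reflection) with hcan | hncan
      · -- the junction CANCELS: remove `S b₁` and `μk`
        rcases Classical.em (L = []) with hL | hL
        · -- `β = [b₁]`: `γ = κ.tail`
          refine ⟨μk1 :: c :: cs, hκtail_l, hκtail_c, by simp, ⟨μ₁, hκtail_last, hμ₁0⟩, ?_⟩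
          rw [himg₀, hβ1, hL, List.nil_append, List.map_cons, List.map_nil, hκdef, List.singleton_append,
            wordFrame_cons_cons_cancel A₁ hcan]
        · -- `|β| ≥ 2`: the far level-two hypothesis keeps the next junction reduced
          rcases hP2far with hlen | ⟨w, b₂', b₁', hw₀, hdisj⟩
          · exfalso
            obtain ⟨l₀, L', rfl⟩ := List.exists_cons_of_ne_nil hL
            rw [← hβ, hβ1] at hlen; simp at hlen
          have hw : β = w ++ [b₂', b₁'] := by rw [hβ]; exact hw₀
          have hb₁' : b₁' = b₁ := by
            have h1 := congrArg List.getLast? (hw.symm.trans hβ1)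
            simpa using h1
          subst hb₁'
          have h2 : (ℝ ∙ S b₂')ᗮ.reflection ≠ (ℝ ∙ μk1)ᗮ.reflection := by
            rcases hdisj with h | h
            · exact absurd hcan h
            · exact h
          have hb₂' : b₂' ∈ β := by rw [hw]; simp
          have hSb₂ := hβSl (S b₂') (List.mem_map.2 ⟨b₂', hb₂', rfl⟩)
          have hpre_mem : ∀ μ ∈ w.map S ++ [S b₂'], μ ∈ β.map S := by
            intro μ hμ
            rw [hw, List.map_append, List.map_cons, List.map_cons, List.map_nil]
            rcases List.mem_append.1 hμ with h | h
            · exact List.mem_append_left _ h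
            · rw [List.mem_singleton] at h; rw [h]; simp
          have hpre_c : List.IsChain (fun μ μ' => ⟪μ, μ'⟫_ℝ = 1 / 3 ∨ ⟪μ, μ'⟫_ℝ = -1 / 3) (w.map S ++ [S b₂']) := by
            have h' : β.map S = (w.map S ++ [S b₂']) ++ [S b₁'] := by
              rw [hw, List.map_append, List.map_cons, List.map_cons, List.map_nil, List.append_assoc]; rfl
            rw [h'] at hβSc
            exact (List.isChain_append.1 hβSc).1
          refine ⟨(w.map S ++ [S b₂']) ++ (μk1 :: c :: cs), ?_, ?_, by simp; omega, ⟨μ₁, ?_, hμ₁0⟩, ?_⟩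
          · intro μ hμ
            rcases List.mem_append.1 hμ with h | h
            · exact hβSl μ (hpre_mem μ h)
            · exact hκtail_l μ h
          · rw [List.isChain_append]
            refine ⟨hpre_c, hκtail_c, fun x hx y hy => ?_⟩
            have hx' : S b₂' = x := by simpa using hx
            have hy' : μk1 = y := by simpa using hy
            rw [← hx', ← hy']
            exact hjunction _ _ hSb₂ hμk1 h2
          · rw [List.getLast?_append, hκtail_last]; rfl
          · rw [himg₀, hw, List.map_append, List.map_cons, List.map_cons, List.map_nil, hκdef]
            rw [show (w.map S ++ [S b₂', S b₁']) ++ μk :: μk1 :: c :: cs =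
                (w.map S ++ [S b₂']) ++ S b₁' :: μk :: (μk1 :: c :: cs) by simp]
            rw [wordFrame_append_cons_cons_cancel A₁ _ hcan]
      · -- the junction is REDUCED: `γ = β.map S ++ κ`
        refine ⟨β.map S ++ κ, ?_, ?_, by rw [hκdef]; simp; omega, ⟨μ₁, by rw [List.getLast?_append, hκlast]; rfl, hμ₁0⟩,
          himg₀⟩
        · intro μ hμ
          rcases List.mem_append.1 hμ with h | h
          · exact hβSl μ h
          · exact hκl μ h
        · rw [List.isChain_append]
          refine ⟨hβSc, hκc, fun x hx y hy => ?_⟩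
          have hx' : S b₁ = x := by rw [hβ1] at hx; simpa using hx
          have hy' : μk = y := by rw [hκdef] at hy; simpa using hy
          rw [← hx', ← hy']
          exact hjunction _ _ hSb₁ hμk hncan
  obtain ⟨γ, hγl, hγc, hγ2, hγlast, himg₂⟩ := hfar
  -- the main step, as in `not_coaxial_of_word`
  have main : ∀ α : List (EuclideanSpace ℝ (Fin 3)),
      (∀ μ ∈ α, ‖μ‖ = 1 ∧
        ∀ w ∈ fccSlots, ⟪w, μ⟫_ℝ = 0 ∨ ⟪w, μ⟫_ℝ = Real.sqrt (2 / 3) ∨ ⟪w, μ⟫_ℝ = -Real.sqrt (2 / 3)) →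
      List.IsChain (fun μ μ' => ⟪μ, μ'⟫_ℝ = 1 / 3 ∨ ⟪μ, μ'⟫_ℝ = -1 / 3) α →
      (α.length ≤ 1 ∨ ∃ lam, α.getLast? = some lam ∧ ⟪u₁, lam⟫_ℝ = Real.sqrt (2 / 3)) →
      (wordFrame A₁ α : EuclideanSpace ℝ (Fin 3) → EuclideanSpace ℝ (Fin 3)) '' ↑fccSlots =
        (wordFrame A₁ γ : EuclideanSpace ℝ (Fin 3) → EuclideanSpace ℝ (Fin 3)) '' ↑fccSlots → False :=
    fun α hl hc hP himg => false_of_map_reflection_eq (fun μ hμ => (hl μ hμ).1) (fun μ hμ => (hγl μ hμ).1) hP hγ2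
      hγlast (map_reflection_eq_of_image_eq A₁ hl hc hγl hγc himg)
  rcases eq_or_twin_of_coaxial e₁.frame e₂.frame hco with hEq | ⟨m, hm, hmenu, hEq⟩
  · have himg := image_fccSlots_eq_of_image_fcc_eq _ _ hEq
    rw [hF₁, himg₂] at himg
    exact main _ hαl hαc (length_le_one_or_getLast_pos _ hαpos) himg
  · set m' := e₁.frame.symm m with hm'
    have hm'u : ‖m'‖ = 1 := by rw [hm', LinearIsometryEquiv.norm_map, hm]
    have hm'm : ∀ w ∈ fccSlots, ⟪w, m'⟫_ℝ = 0 ∨ ⟪w, m'⟫_ℝ = Real.sqrt (2 / 3) ∨ ⟪w, m'⟫_ℝ = -Real.sqrt (2 / 3) := by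
      intro w hw
      rw [hm', ← LinearIsometryEquiv.inner_map_map e₁.frame, LinearIsometryEquiv.apply_symm_apply]
      exact hmenu w hw
    have htw : twinFrame e₁.frame m = wordFrame A₁ (m' :: stackWord (e₁ :: r₁)) := by
      rw [twinFrame_eq_reflection_trans e₁.frame hm, wordFrame_cons, ← hm', ← hF₁]
    have himg := image_fccSlots_eq_of_image_fcc_eq _ _ hEq
    rw [himg₂, htw] at himg
    cases hα : stackWord (e₁ :: r₁) with
    | nil =>
      rw [hα] at himg
      exact main [m'] (fun μ hμ => by rw [List.mem_singleton] at hμ; rw [hμ]; exact ⟨hm'u, hm'm⟩)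
        (List.isChain_singleton _) (Or.inl (by simp)) himg.symm
    | cons a α' =>
      rw [hα] at himg hαl hαc hαpos
      obtain ⟨hau, ham⟩ := hαl a List.mem_cons_self
      have hPtail : α'.length ≤ 1 ∨ ∃ lam, α'.getLast? = some lam ∧ ⟪u₁, lam⟫_ℝ = Real.sqrt (2 / 3) := by
        refine length_le_one_or_getLast_pos α' fun μ hμ => hαpos μ ?_
        cases α' with
        | nil => simp at hμ
        | cons b α'' => rw [List.getLast?_cons_cons]; exact hμ
      have hPfull : (m' :: a :: α').length ≤ 1 ∨
          ∃ lam, (m' :: a :: α').getLast? = some lam ∧ ⟪u₁, lam⟫_ℝ = Real.sqrt (2 / 3) := by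
        right
        obtain ⟨lam, hlam⟩ := Option.ne_none_iff_exists'.1
          (mt List.getLast?_eq_none_iff.1 (List.cons_ne_nil a α'))
        exact ⟨lam, by rw [List.getLast?_cons_cons, hlam], hαpos lam hlam⟩
      rcases inner_modelMenu hm'u hau hm'm ham with h | h | h | h
      · have hma : m' = a := (inner_eq_one_iff_of_norm_eq_one (𝕜 := ℝ) hm'u hau).1 h
        rw [wordFrame_cons_cons_cancel A₁ (by rw [hma]) α'] at himg
        exact main α' (fun μ hμ => hαl μ (List.mem_cons_of_mem a hμ)) hαc.tail hPtail himg.symm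
      · have hma : a = -m' := eq_neg_of_inner_eq_neg_one' hm'u hau h
        have hR : (ℝ ∙ m')ᗮ.reflection = (ℝ ∙ a)ᗮ.reflection := by rw [hma, reflection_neg_eq hm'u]
        rw [wordFrame_cons_cons_cancel A₁ hR α'] at himg
        exact main α' (fun μ hμ => hαl μ (List.mem_cons_of_mem a hμ)) hαc.tail hPtail himg.symm
      · exact main (m' :: a :: α') (fun μ hμ => by
            rcases List.mem_cons.1 hμ with rfl | hμ'
            · exact ⟨hm'u, hm'm⟩
            · exact hαl μ hμ')
          (List.isChain_cons.2 ⟨fun b hb => by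
            rw [List.head?_cons, Option.mem_some_iff] at hb; rw [← hb]; exact Or.inl h, hαc⟩) hPfull himg.symm
      · exact main (m' :: a :: α') (fun μ hμ => by
            rcases List.mem_cons.1 hμ with rfl | hμ'
            · exact ⟨hm'u, hm'm⟩
            · exact hαl μ hμ')
          (List.isChain_cons.2 ⟨fun b hb => by
            rw [List.head?_cons, Option.mem_some_iff] at hb; rw [← hb]; exact Or.inr h, hαc⟩) hPfull himg.symm

end Summit.Ventures.Crystal3D.Theorems

end
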